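import Mathlib
import Summits.QuantumAdvantage.QuantumAdvantage.Theorems.MobiusLadderLiouvilleOrthogonalTC0Defs
import Summits.QuantumAdvantage.QuantumAdvantage.Theorems.MobiusLadderLiouvilleOrthogonalTC0StubFactor
import HarnessLib

/-!
# `LiouvilleOrthogonalTC0` (stmt-QuantumAdvantage-1393), line `Sketch` — stub `stub_thin`
# (thin boxes are rare)

Crux `Summit.QuantumAdvantage.QuantumAdvantage.Theses.MobiusLadder.LiouvilleOrthogonalTC0`, line
`Sketch` (card multiplicative-xor-ladder), stub `stub_thin`, PROVED unconditionally (elementary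
counting, Mathlib only, on the vocabulary `locPart`, `pieceSet`, `IsLocal` of the Defs module).

For a prime window `(y, w]`, write `u(N) = locPart y w N` for the `(y, w]`-local part of `N`,
`β(N) = ⌊log u(N) / log(1+θ)⌋₊` for its box index at ratio `1+θ`, and
`U_β = pieceSet n y w ((1+θ)^β) θ` for the piece of the box `[(1+θ)^β, (1+θ)^(β+1))`.  The stub
bounds the number of `N ∈ [1, 2ⁿ)` with `u(N) > V ≥ 1` whose own piece `U_{β(N)}` is THIN
(`#U_{β(N)} < T`) by `T · (4·2ⁿ/(θV) + (n+2)/log(1+θ) + 2)`: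

* `StubThin.pow_floor_log_le_self` — boxes for a real base `b > 1`: `b^β ≤ u < b^(β+1)` for
  `β = ⌊log u / log b⌋₊`, `u ≥ 1` (used with `b = 1 + θ`);
* `StubThin.locPart_mem_pieceSet` — `u(N) ∈ U_{β(N)}` for `0 < N < 2ⁿ` (`u(N) ∣ N`, `u(N)` is
  `(y, w]`-local by `StubFactor.primeFactors_locProd`, and `(1+θ)^β(N) ≤ u(N) < (1+θ)^(β(N)+1)`);
* `StubThin.card_fibre_le` — per box `β`: `N ↦ (u(N), N / u(N))` injects the fibre `{β(N) = β}`
  into `U_β × [0, 2ⁿ/(1+θ)^β]`, so a thin fibre has `≤ T · (2ⁿ/(1+θ)^β + 1)` elements;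
* `StubThin.geom_tail` — `∑_{β ≥ β(V)} (1+θ)^{-β} ≤ (1+θ)^{1-β(V)}/θ ≤ (1+θ)²/(θV) ≤ 4/(θV)`;
* `StubThin.card_le_of_thin` — the boxes met satisfy `β(V) ≤ β ≤ β(2ⁿ) ≤ n log 2 / log(1+θ)`,
  and summing the fibre bounds gives the claim; `stub_thin` is the registered specialisation to the
  window `(z_i, z_{i+1}]`.
-/

set_option linter.dupNamespace false -- D-0017: single-problem summit ⇒ `QuantumAdvantage.QuantumAdvantage` by design

noncomputable section

namespace Summit.QuantumAdvantage.QuantumAdvantage.Theorems.LiouvilleOrthogonalTC0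

open Filter Finset

namespace StubThin

/-! ### Boxes `[b^β, b^(β+1))` for a real base `b > 1` -/

/-- Box bounds for a real base `b > 1` and `u ≥ 1`: with `β = ⌊log u / log b⌋₊` one has
`b^β ≤ u < b^(β+1)` (applied below with `b = 1 + θ`). -/
theorem pow_floor_log_le_self {b u : ℝ} (hb : 1 < b) (hu : 1 ≤ u) :
    b ^ ⌊Real.log u / Real.log b⌋₊ ≤ u ∧ u < b ^ (⌊Real.log u / Real.log b⌋₊ + 1) := by
  have hlog : 0 < Real.log b := Real.log_pos hb
  have hb0 : 0 < b := by linarith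
  have hu0 : 0 < u := by linarith
  have hq : 0 ≤ Real.log u / Real.log b := div_nonneg (Real.log_nonneg hu) hlog.le
  have hfl := Nat.floor_le hq
  have hlt := Nat.lt_floor_add_one (Real.log u / Real.log b)
  constructor
  · have h2 : (⌊Real.log u / Real.log b⌋₊ : ℝ) * Real.log b ≤ Real.log u := by
      calc (⌊Real.log u / Real.log b⌋₊ : ℝ) * Real.log b
          ≤ Real.log u / Real.log b * Real.log b := mul_le_mul_of_nonneg_right hfl hlog.le
        _ = Real.log u := div_mul_cancel₀ _ hlog.ne'
    rw [← Real.log_pow] at h2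
    exact (Real.log_le_log_iff (pow_pos hb0 _) hu0).mp h2
  · have h2 : Real.log u < ((⌊Real.log u / Real.log b⌋₊ : ℝ) + 1) * Real.log b := by
      calc Real.log u = Real.log u / Real.log b * Real.log b := (div_mul_cancel₀ _ hlog.ne').symm
        _ < ((⌊Real.log u / Real.log b⌋₊ : ℝ) + 1) * Real.log b :=
            mul_lt_mul_of_pos_right hlt hlog
    have h3 : Real.log u < Real.log (b ^ (⌊Real.log u / Real.log b⌋₊ + 1)) := by
      rw [Real.log_pow]; push_cast; exact h2
    exact (Real.log_lt_log_iff hu0 (pow_pos hb0 _)).mp h3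

/-- The box index `⌊log u / log b⌋₊` is monotone in `u > 0` for a base `b > 1`. -/
theorem floor_log_div_mono {b u v : ℝ} (hb : 1 < b) (hu : 0 < u) (huv : u ≤ v) :
    ⌊Real.log u / Real.log b⌋₊ ≤ ⌊Real.log v / Real.log b⌋₊ :=
  Nat.floor_le_floor (div_le_div_of_nonneg_right (Real.log_le_log hu huv) (Real.log_pos hb).le)

/-! ### The local part lies in the piece of its own box -/

/-- `locPart y w N ∣ N` for `N ≠ 0` (a sub-product of the factorisation of `N`). -/
theorem locPart_dvd (y w N : ℕ) (hN : N ≠ 0) : locPart y w N ∣ N := by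
  unfold locPart
  conv_rhs => rw [Nat.prod_primeFactors_pow_factorization hN]
  exact Finset.prod_dvd_prod_of_subset _ _ _ (Finset.filter_subset _ _)

/-- For `0 < N < 2ⁿ`, the local part `u = locPart y w N` lies in the piece of its own box
`pieceSet n y w ((1+θ)^β(u)) θ`. -/
theorem locPart_mem_pieceSet (n y w N : ℕ) {θ : ℝ} (hθ : 0 < θ) (hN : N ≠ 0)
    (hN2 : N < 2 ^ n) :
    locPart y w N ∈
      pieceSet n y w ((1 + θ) ^ ⌊Real.log (locPart y w N) / Real.log (1 + θ)⌋₊) θ := by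
  have hu0 : locPart y w N ≠ 0 := StubFactor.locProd_ne_zero N y w
  have hu1 : (1 : ℝ) ≤ locPart y w N := by exact_mod_cast Nat.one_le_iff_ne_zero.mpr hu0
  have hb := pow_floor_log_le_self (by linarith : (1 : ℝ) < 1 + θ) hu1
  unfold pieceSet
  rw [Finset.mem_filter, Finset.mem_range]
  refine ⟨lt_of_le_of_lt (Nat.le_of_dvd (Nat.pos_of_ne_zero hN) (locPart_dvd y w N hN)) hN2,
    ⟨hu0, fun p hp => ?_⟩, hb.1, ?_⟩
  · -- locality: the prime factors of the local part are the prime factors of `N` in `(y, w]`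
    have h : (locPart y w N).primeFactors = N.primeFactors.filter (fun p => y < p ∧ p ≤ w) :=
      StubFactor.primeFactors_locProd N y w
    rw [h] at hp
    exact (Finset.mem_filter.mp hp).2
  · rw [← pow_succ]
    exact hb.2

/-- The lower box bound of a piece element: `u ∈ pieceSet n y w b θ → b ≤ u`. -/
theorem le_of_mem_pieceSet {n y w u : ℕ} {b θ : ℝ} (h : u ∈ pieceSet n y w b θ) :
    b ≤ (u : ℝ) := by
  unfold pieceSet at h
  exact (Finset.mem_filter.mp h).2.2.1

/-! ### Counting -/

/-- Injection count: if on `S` the map `N ↦ (u N, N / u N)` lands in `U × [0, M]` and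
`u N ∣ N`, then `#S ≤ #U · (M + 1)`. -/
theorem card_le_card_mul {S U : Finset ℕ} {M : ℕ} (u : ℕ → ℕ)
    (hu : ∀ N ∈ S, u N ∈ U ∧ u N ∣ N ∧ N / u N ≤ M) : #S ≤ #U * (M + 1) := by
  calc #S ≤ #(U ×ˢ range (M + 1)) := by
        refine Finset.card_le_card_of_injOn (fun N => (u N, N / u N)) (fun N hN => ?_)
          (fun N₁ hN₁ N₂ hN₂ h => ?_)
        · have h := hu N (Finset.mem_coe.mp hN)
          exact Finset.mem_coe.mpr
            (Finset.mem_product.mpr ⟨h.1, Finset.mem_range.mpr (Nat.lt_succ_of_le h.2.2)⟩)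
        · simp only [Prod.mk.injEq] at h
          calc N₁ = u N₁ * (N₁ / u N₁) := (Nat.mul_div_cancel' (hu N₁ hN₁).2.1).symm
            _ = u N₂ * (N₂ / u N₂) := by rw [h.2, h.1]
            _ = N₂ := Nat.mul_div_cancel' (hu N₂ hN₂).2.1
    _ = #U * (M + 1) := by rw [Finset.card_product, Finset.card_range]

/-- Per-box count: a set `S` of `0 < N < 2ⁿ` all of box index `b` and with the piece `U_b` thin
(`#U_b < T`) has `#S ≤ T · (2ⁿ/(1+θ)^b + 1)`. -/
theorem card_fibre_le (n y w b : ℕ) {θ T : ℝ} (hθ : 0 < θ) (hT : 0 ≤ T) (S : Finset ℕ)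
    (hS : ∀ N ∈ S, N ≠ 0 ∧ N < 2 ^ n ∧
      ⌊Real.log (locPart y w N) / Real.log (1 + θ)⌋₊ = b ∧
      (#(pieceSet n y w ((1 + θ) ^ b) θ) : ℝ) < T) :
    (#S : ℝ) ≤ T * (2 ^ n / (1 + θ) ^ b + 1) := by
  have h1θ : (0 : ℝ) < 1 + θ := by linarith
  have hq : (0 : ℝ) < (1 + θ) ^ b := pow_pos h1θ b
  rcases S.eq_empty_or_nonempty with rfl | ⟨N₀, hN₀⟩
  · simp only [Finset.card_empty, Nat.cast_zero]
    positivity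
  have hUT := (hS N₀ hN₀).2.2.2
  have hcard : #S ≤ #(pieceSet n y w ((1 + θ) ^ b) θ) * (⌊(2 : ℝ) ^ n / (1 + θ) ^ b⌋₊ + 1) := by
    refine card_le_card_mul (fun N => locPart y w N) fun N hN => ?_
    obtain ⟨hN0, hN2, hb, -⟩ := hS N hN
    have hmem := locPart_mem_pieceSet n y w N hθ hN0 hN2
    rw [hb] at hmem
    refine ⟨hmem, locPart_dvd y w N hN0, Nat.le_floor ?_⟩
    calc ((N / locPart y w N : ℕ) : ℝ) ≤ (N : ℝ) / (locPart y w N : ℝ) := Nat.cast_div_le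
      _ ≤ (2 : ℝ) ^ n / (1 + θ) ^ b :=
        div_le_div₀ (by positivity) (by exact_mod_cast hN2.le) hq (le_of_mem_pieceSet hmem)
  calc (#S : ℝ)
      ≤ (#(pieceSet n y w ((1 + θ) ^ b) θ) : ℝ) * ((⌊(2 : ℝ) ^ n / (1 + θ) ^ b⌋₊ : ℝ) + 1) := by
        exact_mod_cast hcard
    _ ≤ T * (2 ^ n / (1 + θ) ^ b + 1) := by
        have hfl : (⌊(2 : ℝ) ^ n / (1 + θ) ^ b⌋₊ : ℝ) ≤ (2 : ℝ) ^ n / (1 + θ) ^ b :=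
          Nat.floor_le (by positivity)
        exact mul_le_mul hUT.le (by linarith) (by positivity) hT

/-- Geometric tail over the boxes above `V`: if `0 < V < (1+θ)^(β₁+1)` and `0 < θ ≤ 1` then
`∑_{β₁ ≤ b < m} (1+θ)^{-b} ≤ (1+θ)^{1-β₁}/θ ≤ (1+θ)²/(θV) ≤ 4/(θV)`. -/
theorem geom_tail {θ V : ℝ} (hθ : 0 < θ) (hθ1 : θ ≤ 1) (hV : 0 < V) {β₁ : ℕ}
    (hVq : V < (1 + θ) ^ (β₁ + 1)) (m : ℕ) :
    ∑ b ∈ Ico β₁ m, ((1 + θ) ^ b)⁻¹ ≤ 4 / (θ * V) := by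
  have h0 : (0 : ℝ) < 1 + θ := by linarith
  have hne : (1 : ℝ) + θ ≠ 0 := h0.ne'
  have hr0 : (0 : ℝ) ≤ (1 + θ)⁻¹ := inv_nonneg.mpr h0.le
  have hr1 : (1 + θ)⁻¹ < (1 : ℝ) := inv_lt_one_of_one_lt₀ (by linarith)
  have hq : (0 : ℝ) < (1 + θ) ^ β₁ := pow_pos h0 _
  have hVq' : V * ((1 + θ) ^ β₁)⁻¹ ≤ 1 + θ := by
    rw [← div_eq_mul_inv, div_le_iff₀ hq, mul_comm, ← pow_succ]
    exact hVq.le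
  have h1r : (1 : ℝ) - (1 + θ)⁻¹ = θ / (1 + θ) := by
    field_simp
    ring
  calc ∑ b ∈ Ico β₁ m, ((1 + θ) ^ b)⁻¹ = ∑ b ∈ Ico β₁ m, ((1 + θ)⁻¹) ^ b := by
        simp_rw [inv_pow]
    _ ≤ ((1 + θ)⁻¹) ^ β₁ / (1 - (1 + θ)⁻¹) := geom_sum_Ico_le_of_lt_one hr0 hr1
    _ = ((1 + θ) ^ β₁)⁻¹ * (1 + θ) / θ := by rw [h1r, inv_pow, div_div_eq_mul_div]
    _ ≤ 4 / (θ * V) := by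
        rw [div_le_div_iff₀ hθ (by positivity)]
        calc ((1 + θ) ^ β₁)⁻¹ * (1 + θ) * (θ * V)
            = θ * (1 + θ) * (V * ((1 + θ) ^ β₁)⁻¹) := by ring
          _ ≤ θ * (1 + θ) * (1 + θ) := mul_le_mul_of_nonneg_left hVq' (by positivity)
          _ ≤ 4 * θ := by
              nlinarith [mul_nonneg (mul_nonneg hθ.le (sub_nonneg.mpr hθ1))
                (by linarith : (0 : ℝ) ≤ 3 + θ)]

/-- **Thin boxes are rare (general window `(y, w]`).** If every `N ∈ A` satisfies `0 < N < 2ⁿ`,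
`locPart y w N > V ≥ 1` and the piece of the box of `locPart y w N` has fewer than `T` elements,
then `#A ≤ T · (4·2ⁿ/(θV) + (n+2)/log(1+θ) + 2)`. -/
theorem card_le_of_thin (n y w : ℕ) {θ T V : ℝ} (hθ : 0 < θ) (hθ1 : θ ≤ 1) (hT : 0 ≤ T)
    (hV : 1 ≤ V) (A : Finset ℕ)
    (hA : ∀ N ∈ A, N ≠ 0 ∧ N < 2 ^ n ∧ V < (locPart y w N : ℝ) ∧
      (#(pieceSet n y w ((1 + θ) ^ ⌊Real.log (locPart y w N) / Real.log (1 + θ)⌋₊) θ) : ℝ)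
        < T) :
    (#A : ℝ) ≤ T * (4 * 2 ^ n / (θ * V) + ((n : ℝ) + 2) / Real.log (1 + θ) + 2) := by
  have h1θ : (1 : ℝ) < 1 + θ := by linarith
  have hL : 0 < Real.log (1 + θ) := Real.log_pos h1θ
  -- the boxes met: `β(V) ≤ β(N) ≤ β(2ⁿ)`
  have hmaps : (A : Set ℕ).MapsTo (fun N => ⌊Real.log (locPart y w N) / Real.log (1 + θ)⌋₊)
      (Ico ⌊Real.log V / Real.log (1 + θ)⌋₊
        (⌊Real.log ((2 : ℝ) ^ n) / Real.log (1 + θ)⌋₊ + 1)) := by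
    intro N hN
    obtain ⟨hN0, hN2, hVu, -⟩ := hA N (Finset.mem_coe.mp hN)
    have hu2 : (locPart y w N : ℝ) ≤ (2 : ℝ) ^ n := by
      have h := Nat.le_of_dvd (Nat.pos_of_ne_zero hN0) (locPart_dvd y w N hN0)
      exact_mod_cast (h.trans hN2.le)
    rw [Finset.mem_coe, Finset.mem_Ico]
    exact ⟨floor_log_div_mono h1θ (by linarith) hVu.le,
      Nat.lt_succ_of_le (floor_log_div_mono h1θ (by linarith) hu2)⟩
  -- per-box bound
  have hfib : ∀ b ∈ Ico ⌊Real.log V / Real.log (1 + θ)⌋₊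
      (⌊Real.log ((2 : ℝ) ^ n) / Real.log (1 + θ)⌋₊ + 1),
      (#(A.filter fun N => ⌊Real.log (locPart y w N) / Real.log (1 + θ)⌋₊ = b) : ℝ) ≤
        T * (2 ^ n / (1 + θ) ^ b + 1) := by
    intro b _
    refine card_fibre_le n y w b hθ hT _ fun N hN => ?_
    rw [Finset.mem_filter] at hN
    obtain ⟨hNA, hb⟩ := hN
    obtain ⟨hN0, hN2, -, hT'⟩ := hA N hNA
    rw [hb] at hT'
    exact ⟨hN0, hN2, hb, hT'⟩
  -- geometric tail over the boxes
  have hgeom : ∑ b ∈ Ico ⌊Real.log V / Real.log (1 + θ)⌋₊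
      (⌊Real.log ((2 : ℝ) ^ n) / Real.log (1 + θ)⌋₊ + 1), ((1 + θ) ^ b)⁻¹ ≤ 4 / (θ * V) :=
    geom_tail hθ hθ1 (by linarith) (pow_floor_log_le_self h1θ hV).2 _
  -- number of boxes
  have hcount : (#(Ico ⌊Real.log V / Real.log (1 + θ)⌋₊
      (⌊Real.log ((2 : ℝ) ^ n) / Real.log (1 + θ)⌋₊ + 1)) : ℝ) ≤
      ((n : ℝ) + 2) / Real.log (1 + θ) + 1 := by
    rw [Nat.card_Ico]
    have h1 : ((⌊Real.log ((2 : ℝ) ^ n) / Real.log (1 + θ)⌋₊ + 1 -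
        ⌊Real.log V / Real.log (1 + θ)⌋₊ : ℕ) : ℝ) ≤
        (⌊Real.log ((2 : ℝ) ^ n) / Real.log (1 + θ)⌋₊ : ℝ) + 1 := by
      exact_mod_cast Nat.sub_le _ _
    have h2 : (⌊Real.log ((2 : ℝ) ^ n) / Real.log (1 + θ)⌋₊ : ℝ) ≤
        Real.log ((2 : ℝ) ^ n) / Real.log (1 + θ) :=
      Nat.floor_le (div_nonneg (Real.log_nonneg (one_le_pow₀ (by norm_num))) hL.le)
    have h3 : Real.log ((2 : ℝ) ^ n) ≤ (n : ℝ) + 2 := by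
      rw [Real.log_pow]
      have h4 : (n : ℝ) * Real.log 2 ≤ n * 1 :=
        mul_le_mul_of_nonneg_left (by linarith [Real.log_two_lt_d9]) (Nat.cast_nonneg n)
      linarith
    have h5 := div_le_div_of_nonneg_right h3 hL.le
    linarith
  -- assemble
  have hcardA := Finset.card_eq_sum_card_fiberwise hmaps
  calc (#A : ℝ) = ∑ b ∈ Ico ⌊Real.log V / Real.log (1 + θ)⌋₊
        (⌊Real.log ((2 : ℝ) ^ n) / Real.log (1 + θ)⌋₊ + 1),
        (#(A.filter fun N => ⌊Real.log (locPart y w N) / Real.log (1 + θ)⌋₊ = b) : ℝ) := by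
        exact_mod_cast hcardA
    _ ≤ ∑ b ∈ Ico ⌊Real.log V / Real.log (1 + θ)⌋₊
        (⌊Real.log ((2 : ℝ) ^ n) / Real.log (1 + θ)⌋₊ + 1), T * (2 ^ n / (1 + θ) ^ b + 1) :=
        Finset.sum_le_sum hfib
    _ = T * (2 ^ n * ∑ b ∈ Ico ⌊Real.log V / Real.log (1 + θ)⌋₊
        (⌊Real.log ((2 : ℝ) ^ n) / Real.log (1 + θ)⌋₊ + 1), ((1 + θ) ^ b)⁻¹) +
        T * #(Ico ⌊Real.log V / Real.log (1 + θ)⌋₊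
          (⌊Real.log ((2 : ℝ) ^ n) / Real.log (1 + θ)⌋₊ + 1)) := by
        rw [Finset.mul_sum, Finset.mul_sum, Finset.card_eq_sum_ones, Nat.cast_sum, Finset.mul_sum,
          ← Finset.sum_add_distrib]
        refine Finset.sum_congr rfl fun b _ => ?_
        push_cast
        ring
    _ ≤ T * (2 ^ n * (4 / (θ * V))) + T * (((n : ℝ) + 2) / Real.log (1 + θ) + 1) := by
        apply add_le_add
        · exact mul_le_mul_of_nonneg_left (mul_le_mul_of_nonneg_left hgeom (by positivity)) hT
        · exact mul_le_mul_of_nonneg_left hcount hT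
    _ ≤ T * (4 * 2 ^ n / (θ * V) + ((n : ℝ) + 2) / Real.log (1 + θ) + 2) := by
        have h : T * (2 ^ n * (4 / (θ * V))) + T * (((n : ℝ) + 2) / Real.log (1 + θ) + 1) + T =
            T * (4 * 2 ^ n / (θ * V) + ((n : ℝ) + 2) / Real.log (1 + θ) + 2) := by ring
        linarith

end StubThin

/-- **Stub `stub_thin` (thin pieces are rare).** For a coordinate `i`, the `N ∈ [1, 2ⁿ)` whose
`i`-th local part `u = locPart zᵢ zᵢ₊₁ N` exceeds `V ≥ 1` but falls in a THIN box (the piece of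
its own box `⌊log u/log(1+θ)⌋₊` has fewer than `T` elements) number at most
`T · (4·2ⁿ/(θV) + (n+2)/log(1+θ) + 2)`: inject `N ↦ (u, N/u)`, count `≤ T·(2ⁿ/(1+θ)^β + 1)` per
box `β`, and sum the geometric series over the boxes `β` with `(1+θ)^(β+1) > V`,
`(1+θ)^β ≤ 2ⁿ`. -/
theorem stub_thin (n k : ℕ) (θ : ℝ) (hθ : 0 < θ) (hθ1 : θ ≤ 1) (z : Fin (k + 1) → ℕ) (i : Fin k)
    (T V : ℝ) (hT : 0 ≤ T) (hV : 1 ≤ V) :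
    (#((range (2 ^ n)).filter fun N => N ≠ 0 ∧
        V < (locPart (z i.castSucc) (z i.succ) N : ℝ) ∧
        (#(pieceSet n (z i.castSucc) (z i.succ)
            ((1 + θ) ^ ⌊Real.log (locPart (z i.castSucc) (z i.succ) N) / Real.log (1 + θ)⌋₊) θ)
          : ℝ) < T) : ℝ) ≤
      T * (4 * 2 ^ n / (θ * V) + ((n : ℝ) + 2) / Real.log (1 + θ) + 2) := by
  refine StubThin.card_le_of_thin n (z i.castSucc) (z i.succ) hθ hθ1 hT hV _ fun N hN => ?_
  rw [Finset.mem_filter, Finset.mem_range] at hN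
  exact ⟨hN.2.1, hN.1, hN.2.2.1, hN.2.2.2⟩

end Summit.QuantumAdvantage.QuantumAdvantage.Theorems.LiouvilleOrthogonalTC0
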